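import Mathlib
import Summits.KontsevichZagierPeriods.Zeta5Search.FourthOrderKappa
import Summits.KontsevichZagierPeriods.Zeta5Search.FourthDigitVTransport
import Summits.KontsevichZagierPeriods.Zeta5Search.FourthOrderFrameExp
import HarnessLib

/-!
# ζ(5) search — the FOURTH-ORDER ORBIT LEMMA (pair lemma) for THEOREM L5 (`SecondResidueLaw.LawA5`)

Cell `pub-zeta5` (HONEST FRAMING: systematic search; no irrationality claim unless certified), typer seat generation 13.
REPORT-gen2-g14 §2, Lemmas O + P: in a frame `(M, T)` (`M ≥ 10` even, `T` palindromic, `E(T) = −M`) a LIVE class `x` (multipole,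
`E_x ≤ −M+3`) together with its conjugate `x̄` contributes to `(Σ_y Ω_y, Σ_y N_y)` the vector
`A_x·t₁ + C_x·t₃ + O(p⁴)` with `t_n = σ_T[(η − L/2)^n Φ_T]` (`frameTW/V`), `‖A_x‖ ≤ p⁻¹` and **`C_x ≡ −2p³ ĝ_x κ_{3−i}(x) (mod p⁴)`**
(`pair₅`; given the classwise fourth digits `FourthDigitW/V` by name).  Ingredients: `classFrameW/V` (class ⇒ `σ_T[H_x Φ_T]`),
`classH_reflect` (Lemma R: `H_x̄ ≡ −H_x(L − ·)`), `framePoly_oddPart` (Lemma P), `padicNorm_classTaylor_*` (the `τ₃`-digit), and for the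
deep layer the first-digit cancellation of the `λ_p`-term (`ŵ_x = ŵ_x̄`, `ĝ_x + ĝ_x̄ ≡ 0`).  Also: `live_dominates` (the class clauses
`LawA4Classes ∧ ShapeClause` give domination data for every live class).  `p`-adic norms of rationals; nothing here bears on irrationality.
-/

noncomputable section

open Finset PowerSeries

namespace Summit.KontsevichZagierPeriods.Zeta5Search.SecondOrder

open Summit.KontsevichZagierPeriods.Zeta5Search.CasoratianValuation (InPolytope)
open Summit.KontsevichZagierPeriods.Zeta5Search.ClusterValuation
open Summit.KontsevichZagierPeriods.Zeta5Search.PadicSeries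
open Summit.KontsevichZagierPeriods.Zeta5Search.CellA (classW padicNorm_p)
open Summit.KontsevichZagierPeriods.Zeta5Search.LevelClass (typeExp typeW level_mem)
open Summit.KontsevichZagierPeriods.Zeta5Search.BigPrime (padicNorm_mul_le_one)
open Summit.KontsevichZagierPeriods.Zeta5Search.RecordWindowsA4 (LawA4Classes)
open Summit.KontsevichZagierPeriods.Zeta5Search.SecondResidueLaw (phi3Hat cubicHat lambdaP isRaiseN ShapeClause FourthDigitW FourthDigitV)

variable {p : ℕ} [hp : Fact p.Prime]

/-! ## §1 The frame directions `t_n = σ_T[(η − L/2)^n Φ_T]` -/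

/-- `t_n,W := ŵ[(η − L/2)^n Φ_T]` (`t₁ = τ_W/2`, `t₃ = τ₃,W/8`). -/
def frameTW (n L : ℕ) (e : ℕ → ℤ) : ℚ := frameWPoly L e ((Polynomial.X - Polynomial.C ((L : ℚ) / 2)) ^ n)

/-- `t_n,V := v̂[(η − L/2)^n Φ_T]`. -/
def frameTV (n L : ℕ) (e : ℕ → ℤ) : ℚ := frameVPoly L e ((Polynomial.X - Polynomial.C ((L : ℚ) / 2)) ^ n)

/-- The frame directions are `p`-integral (`L < p`). -/
theorem padicNorm_frameT_le_one (hp2 : p ≠ 2) {L : ℕ} (hL : L < p) (e : ℕ → ℤ) (n : ℕ) :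
    padicNorm p (frameTW n L e) ≤ 1 ∧ padicNorm p (frameTV n L e) ≤ 1 := by
  have hc : CoeffBound p 0 0 (((Polynomial.X - Polynomial.C ((L : ℚ) / 2)) ^ n : Polynomial ℚ) : PowerSeries ℚ) := by
    rw [Polynomial.coe_pow, sub_eq_add_neg, ← map_neg, Polynomial.coe_add, Polynomial.coe_X, Polynomial.coe_C]
    have h1 : CoeffBound p 0 0 (X + C (-((L : ℚ) / 2))) := by
      refine coeffBound_X_add_C le_rfl ?_
      rw [neg_zero, zpow_zero, padicNorm.neg]; exact padicNorm_half_L_le_one hp2 L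
    simpa using h1.pow n
  have hcoef : ∀ k, padicNorm p (((Polynomial.X - Polynomial.C ((L : ℚ) / 2)) ^ n).coeff k) ≤ (p : ℚ) ^ (-(0 : ℤ)) := fun k => by
    rw [← Polynomial.coeff_coe]; simpa using hc k
  unfold frameTW frameTV
  exact ⟨by simpa using padicNorm_frameWPoly_le hL e hcoef, by simpa using padicNorm_frameVPoly_le hL e hcoef⟩

/-! ## §2 Domination data of the live classes -/

section Live

variable (b : ℕ → ℤ) (hb : InPolytope b) (hp5 : 5 ≤ p) (hpn : (p : ℤ) ≤ b 0) {M : ℕ} (hM : 10 ≤ M) {T : List ℤ}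
  (hC : LawA4Classes b p M T) (hS : ShapeClause b p M T)
include hb hp5 hpn hM hC hS

omit hb hp5 hM in
/-- **Every live class dominates the frame type** (from the class clauses). -/
theorem live_dominates {x : ℕ} (hx : x < p) (h2 : 2 ≤ classPoleCount b p x) (hE : classExp b p x ≤ -(M : ℤ) + 3) :
    ∃ a, Dominates (tTop T) (tList T) (topLevel b p x) (fun k => netExp b (x + k * p)) a := by
  have hxn : x ≤ (b 0).toNat := le_b0_of_lt b hpn hx
  have hν := classNu_eq_of_multipole b h2
  obtain ⟨c1, -, c3, c4, c5⟩ := hC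
  have hmem : x ∈ multipoleClasses b p := mem_filter.2 ⟨mem_range.2 hx, h2⟩
  have hlo := c1 x hmem
  have hne := classTypeList_ne_nil b p x
  suffices h : ∃ a, Dominates (tTop T) (tList T) (tTop (classTypeList b p x)) (tList (classTypeList b p x)) a by
    obtain ⟨a, ha⟩ := h; exact ⟨a, dominates_class b hxn ha⟩
  have h1 : 1 ≤ classPoleCount b p x := by omega
  rcases (show classExp b p x = -(M : ℤ) ∨ classExp b p x = -(M : ℤ) + 1 ∨ classExp b p x = -(M : ℤ) + 2 ∨
      classExp b p x = -(M : ℤ) + 3 by omega) with h | h | h | h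
  · exact dominates_of_eq (c3 x hmem h).2 hne
  · rcases c4 x hx h1 (by rw [hν, h]) with hr | ⟨-, -, ht⟩
    · exact dominates_of_isRaise hr hne
    · exact dominates_of_eq ht hne
  · exact dominates_of_isRaise2 (c5 x hx h1 (by rw [hν, h])) hne
  · rcases hS x hx h1 (by rw [hν, h]) with hr | ⟨-, -, hr⟩
    · exact dominates_of_isRaiseN 3 _ _ hr hne
    · exact dominates_of_isRaiseN 2 _ _ hr hne

end Live

/-! ## §3 The pair lemma -/

section Pair

variable (b : ℕ → ℤ) (hb : InPolytope b) (hp5 : 5 ≤ p) (hpn : (p : ℤ) ≤ b 0) (hwin : (b 0 + 2 : ℤ) < (p : ℤ) ^ 2)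
  {M : ℕ} (hM : 10 ≤ M) (hMe : Even M) {L : ℕ} {e : ℕ → ℤ} (hpal : ∀ j ≤ L, e (L - j) = e j) (hTM : typeExp L e = -(M : ℤ))
  (hW4 : FourthDigitW) (hV4 : FourthDigitV)
include hb hp5 hpn hwin hM hMe hpal hTM hW4 hV4

omit hp hp5 hpn hM hMe hpal hTM hW4 hV4 in
/-- The top level of a class is `< p` (window `b₀ < p² − 2`). -/
theorem topLevel_lt (x : ℕ) : topLevel b p x < p := by
  have hxn : (b 0).toNat < p * p := by
    have := hwin; have h0 := hb.1.1; zify; rw [Int.toNat_of_nonneg h0]; nlinarith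
  unfold topLevel
  exact Nat.div_lt_of_lt_mul (by omega)

/-- **PAIR LEMMA (fourth order).**  For a live class `x` (multipole, `E_x ≤ −M+3`) dominating the palindromic frame type
`(L, e)` (`E(T) = −M`) at offset `a`:  there are `A, C` with `‖A‖ ≤ p⁻¹`, `‖C + 2p³ĝ_xκ_{3−i}(x)‖ ≤ p⁻⁴` and
`(Ω_x + Ω_x̄, N_x + N_x̄) ≡ A·t₁ + C·t₃ (mod p⁴)`. -/
theorem pair₅ {x : ℕ} (hx : x < p) (h2 : 2 ≤ classPoleCount b p x) (hE3 : classExp b p x ≤ -(M : ℤ) + 3)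
    (hEm : -(M : ℤ) ≤ classExp b p x) {a : ℕ} (hdom : Dominates L e (topLevel b p x) (fun k => netExp b (x + k * p)) a)
    {i : ℕ} (hi : classExp b p x + M = i) (hdeepw : i = 0 → wHat b p (conjClass b p x) = wHat b p x) :
    ∃ A C : ℚ, padicNorm p A ≤ (p : ℚ) ^ (-(1 : ℤ)) ∧
      padicNorm p (C + 2 * (p : ℚ) ^ 3 * gHat b p x * kappaQ b p x (3 - i)) ≤ (p : ℚ) ^ (-(4 : ℤ)) ∧
      padicNorm p (classW b p x / (-(p : ℚ)) ^ (-(M : ℤ) + 3) + classW b p (conjClass b p x) / (-(p : ℚ)) ^ (-(M : ℤ) + 3)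
        - A * frameTW 1 L e - C * frameTW 3 L e) ≤ (p : ℚ) ^ (-(4 : ℤ)) ∧
      padicNorm p (classV b p x / (-(p : ℚ)) ^ (-(M : ℤ)) + classV b p (conjClass b p x) / (-(p : ℚ)) ^ (-(M : ℤ))
        - A * frameTV 1 L e - C * frameTV 3 L e) ≤ (p : ℚ) ^ (-(4 : ℤ)) := by
  have hp2 : p ≠ 2 := by omega
  have hp0 : (p : ℚ) ≠ 0 := Nat.cast_ne_zero.2 hp.out.ne_zero
  have h0 : 0 ≤ b 0 := hb.1.1
  have hxn : x ≤ (b 0).toNat := le_b0_of_lt b hpn hx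
  have hpnN : p ≤ (b 0).toNat := by have := hb.1.1; omega
  obtain ⟨hL, hL'⟩ := level_bounds' (p := p) b hxn
  set L' := topLevel b p x with hL'def
  have hLp : L < p := by have := hdom.le; have := topLevel_lt b hb hwin x; omega
  have hi3 : i ≤ 3 := by omega
  have hEM : 0 ≤ classExp b p x + M := by omega
  have hE4 : classExp b p x ≤ -4 := by omega
  have hpole : 1 ≤ classPoleCount b p x := by omega
  -- the conjugate class
  set xb := conjClass b p x with hxbdef
  have hxb : xb < p := conjClass_lt b hp.out.pos x
  have hxbn : xb ≤ (b 0).toNat := le_b0_of_lt b hpn hxb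
  have hEc : classExp b p xb = classExp b p x := classExp_conj b h0 hxn
  have hPc : classPoleCount b p xb = classPoleCount b p x := classPoleCount_conj b h0 hxn
  have hdom' := dominates_conj b hb hpn hx hdom hpal
  -- the two classes as frame functionals
  have hWx := classFrameW b hb hp5 hwin hx hxn hdom hW4 hpole hEM
  have hVx := classFrameV b hb hp5 hwin hx hxn hdom hV4 hpole hEM hE4
  have hWc := classFrameW b hb hp5 hwin hxb hxbn hdom' hW4 (by rw [hPc]; exact hpole) (by rw [hEc]; exact hEM)
  have hVc := classFrameV b hb hp5 hwin hxb hxbn hdom' hV4 (by rw [hPc]; exact hpole) (by rw [hEc]; exact hEM) (by rw [hEc]; exact hE4)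
  set Hx := classH b p x M L a e with hHx
  set Hc := classH b p xb M L (L' - L - a) e with hHc
  -- Lemma R: `H_x̄ + H_x(L − X)` is `O(p⁴)` coefficientwise
  have hR := classH_reflect b hb hp5 hpn hx hMe hTM hdom hpal hpole hEM
  have hRW : padicNorm p (frameWPoly L e (Hc + Hx.comp (Polynomial.C (L : ℚ) - Polynomial.X))) ≤ (p : ℚ) ^ (-(4 : ℤ)) :=
    padicNorm_frameWPoly_le hLp e hR
  have hRV : padicNorm p (frameVPoly L e (Hc + Hx.comp (Polynomial.C (L : ℚ) - Polynomial.X))) ≤ (p : ℚ) ^ (-(4 : ℤ)) :=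
    padicNorm_frameVPoly_le hLp e hR
  -- Lemma P: the odd part
  have hdeg : Hx.natDegree ≤ 6 := natDegree_classH_le b hpn hx hTM hdom hi hi3
  have hL2 : (2 * ((L : ℚ) / 2)) = L := by ring
  have hOW := framePoly_oddPart (frameWPoly L e) (frameWPoly_add L e) (frameWPoly_C_mul L e) Hx hdeg ((L : ℚ) / 2)
  have hOV := framePoly_oddPart (frameVPoly L e) (frameVPoly_add L e) (frameVPoly_C_mul L e) Hx hdeg ((L : ℚ) / 2)
  rw [hL2] at hOW hOV
  set h₁ := (Polynomial.taylor ((L : ℚ) / 2) Hx).coeff 1 with hh₁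
  set h₃ := (Polynomial.taylor ((L : ℚ) / 2) Hx).coeff 3 with hh₃
  set h₅ := (Polynomial.taylor ((L : ℚ) / 2) Hx).coeff 5 with hh₅
  have hn1 := padicNorm_classTaylor_one b hp5 hpn hx hTM hdom hi
  have hn3 := padicNorm_classTaylor_three b hp5 hpn hx hTM hdom hi hi3
  have hn5 := padicNorm_classTaylor_five b hp5 hpn hx hTM hdom hi
  have h2n : padicNorm p (2 : ℚ) = 1 := padicNorm_two hp2
  obtain ⟨ht5W, ht5V⟩ := padicNorm_frameT_le_one hp2 hLp e 5
  -- the `λ_p`-terms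
  have hlam : padicNorm p ((-(p : ℚ)) ^ (classExp b p x + M) * gHat b p x * ((p : ℚ) ^ 3 * lambdaP p * wHat b p x)
      + (-(p : ℚ)) ^ (classExp b p xb + M) * gHat b p xb * ((p : ℚ) ^ 3 * lambdaP p * wHat b p xb)) ≤ (p : ℚ) ^ (-(4 : ℤ)) := by
    obtain ⟨-, -, -, hn⟩ := thmA_data b hb hwin
    have hw1 : ∀ y, padicNorm p (wHat b p y) ≤ 1 := fun y => LevelClass.padicNorm_wHat_le_one b h0 hn hp2 y
    have hg1 : ∀ y, padicNorm p (gHat b p y) ≤ 1 := fun y => padicNorm_gHat_le_one' b hp5 y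
    have hlamP : padicNorm p (lambdaP p) ≤ 1 := padicNorm_lambdaP_le_one hp5
    have hp3 : padicNorm p ((p : ℚ) ^ 3) ≤ (p : ℚ) ^ (-(3 : ℤ)) := fo_ppow 3
    rw [hEc, hi]
    rcases Nat.eq_zero_or_pos i with hi0 | hipos
    · -- deep pair: `ŵ_x = ŵ_x̄`, `ĝ_x + ĝ_x̄ ≡ 0 (mod p)`
      rw [hi0, Nat.cast_zero, zpow_zero, one_mul, one_mul, hdeepw hi0]
      have hEodd : Odd (classExp b p x + 1) := by
        rw [show classExp b p x = -(M : ℤ) by omega]; obtain ⟨r, hr⟩ := hMe; exact ⟨-(r : ℤ), by rw [hr]; push_cast; ring⟩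
      have hA := gHat_conj_fourth' b hb hp5 hpn hx hL hL' hpole
      rw [hEodd.neg_one_zpow] at hA
      have hφ := padicNorm_phiHat_le_one b hp2 x
      have hc := padicNorm_curvHat_le_one b hp2 x
      have hc3 := padicNorm_cubicHat_le_one b hp5 x
      have hLn : padicNorm p (L' : ℚ) ≤ 1 := by simpa using padicNorm.of_nat (p := p) L'
      have hLp1 : padicNorm p ((L' : ℚ) * p) ≤ (p : ℚ) ^ (-(1 : ℤ)) := padicNorm_mul_le_right hLn (le_of_eq padicNorm_p)
      have hsum : padicNorm p (gHat b p x + gHat b p xb) ≤ (p : ℚ) ^ (-(1 : ℤ)) := by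
        have eq0 : gHat b p x + gHat b p xb = (gHat b p xb - (-1) * (gHat b p x *
            (1 - (L' : ℚ) * p * phiHat b p x + ((L' : ℚ) * p) ^ 2 * curvHat b p x - ((L' : ℚ) * p) ^ 3 * cubicHat b p x)))
            + gHat b p x * (((L' : ℚ) * p) * (phiHat b p x - (L' : ℚ) * p * curvHat b p x + ((L' : ℚ) * p) ^ 2 * cubicHat b p x)) := by
          ring
        rw [eq0]
        refine fo_add (fo_weak hA (by norm_num)) (padicNorm_mul_le_right (hg1 x) (padicNorm_mul_le_left hLp1 ?_))
        refine fo_add (fo_sub hφ (padicNorm_mul_le_one (padicNorm_mul_le_one hLn padicNorm_p_le_one) hc)) (padicNorm_mul_le_one ?_ hc3)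
        rw [CellA.padicNorm_pow_eq]; exact pow_le_one₀ (padicNorm.nonneg _) (padicNorm_mul_le_one hLn padicNorm_p_le_one)
      have eq1 : gHat b p x * ((p : ℚ) ^ 3 * lambdaP p * wHat b p x) + gHat b p xb * ((p : ℚ) ^ 3 * lambdaP p * wHat b p x) =
          (p : ℚ) ^ 3 * ((lambdaP p * wHat b p x) * (gHat b p x + gHat b p xb)) := by ring
      rw [eq1, show (-(4 : ℤ)) = -(3 + 1) by norm_num]
      exact fo_mul hp3 (fo_imul (padicNorm_mul_le_one hlamP (hw1 x)) hsum)
    · have eq2 : (-(p : ℚ)) ^ (i : ℤ) * gHat b p x * ((p : ℚ) ^ 3 * lambdaP p * wHat b p x)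
          + (-(p : ℚ)) ^ (i : ℤ) * gHat b p xb * ((p : ℚ) ^ 3 * lambdaP p * wHat b p xb) =
          (-(p : ℚ)) ^ (i : ℤ) * ((p : ℚ) ^ 3 * (lambdaP p * (gHat b p x * wHat b p x + gHat b p xb * wHat b p xb))) := by ring
      rw [eq2]
      have hi1 : padicNorm p ((-(p : ℚ)) ^ (i : ℤ)) ≤ (p : ℚ) ^ (-(1 : ℤ)) := by
        rw [LevelClass.padicNorm_neg_p_zpow]; exact zpow_le_zpow_right₀ one_le_p (by omega)
      have := fo_mul hi1 (fo_mul hp3 (show padicNorm p (lambdaP p * (gHat b p x * wHat b p x + gHat b p xb * wHat b p xb)) ≤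
        (p : ℚ) ^ (-(0 : ℤ)) by simpa using padicNorm_mul_le_one hlamP (fo_add (padicNorm_mul_le_one (hg1 _) (hw1 _))
          (padicNorm_mul_le_one (hg1 _) (hw1 _)))))
      simpa using this
  refine ⟨2 * h₁, 2 * h₃, ?_, ?_, ?_, ?_⟩
  · rw [padicNorm.mul, h2n, one_mul]; exact hn1
  · rw [show 2 * h₃ + 2 * (p : ℚ) ^ 3 * gHat b p x * kappaQ b p x (3 - i) = 2 * (h₃ + (p : ℚ) ^ 3 * gHat b p x * kappaQ b p x (3 - i))
      by ring, padicNorm.mul, h2n, one_mul]; exact hn3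
  · -- `W`: (Ω_x − ŵH_x) + (Ω_x̄ − ŵH_x̄) + ŵ(H_x̄ + H_x^r) + 2h₅t₅`
    have elin : frameWPoly L e Hx + frameWPoly L e Hc =
        frameWPoly L e (Hx - Hx.comp (Polynomial.C (L : ℚ) - Polynomial.X)) + frameWPoly L e (Hc + Hx.comp (Polynomial.C (L : ℚ) - Polynomial.X)) := by
      rw [← frameWPoly_add, ← frameWPoly_add]; congr 1; ring
    have eqW : classW b p x / (-(p : ℚ)) ^ (-(M : ℤ) + 3) + classW b p xb / (-(p : ℚ)) ^ (-(M : ℤ) + 3)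
          - 2 * h₁ * frameTW 1 L e - 2 * h₃ * frameTW 3 L e =
        (classW b p x / (-(p : ℚ)) ^ (-(M : ℤ) + 3) - frameWPoly L e Hx) + (classW b p xb / (-(p : ℚ)) ^ (-(M : ℤ) + 3) - frameWPoly L e Hc)
          + frameWPoly L e (Hc + Hx.comp (Polynomial.C (L : ℚ) - Polynomial.X)) + 2 * h₅ * frameTW 5 L e := by
      have := elin; rw [hOW] at this
      unfold frameTW
      rw [pow_one]
      linear_combination this
    rw [eqW]
    refine fo_add (fo_add (fo_add hWx hWc) hRW) ?_
    rw [padicNorm.mul, padicNorm.mul, h2n, one_mul]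
    calc padicNorm p h₅ * padicNorm p (frameTW 5 L e) ≤ (p : ℚ) ^ (-(5 : ℤ)) * 1 :=
          mul_le_mul hn5 ht5W (padicNorm.nonneg _) (zpow_p_nonneg _)
      _ ≤ (p : ℚ) ^ (-(4 : ℤ)) := by rw [mul_one]; exact zpow_le_zpow_right₀ one_le_p (by norm_num)
  · have elin : frameVPoly L e Hx + frameVPoly L e Hc =
        frameVPoly L e (Hx - Hx.comp (Polynomial.C (L : ℚ) - Polynomial.X)) + frameVPoly L e (Hc + Hx.comp (Polynomial.C (L : ℚ) - Polynomial.X)) := by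
      rw [← frameVPoly_add, ← frameVPoly_add]; congr 1; ring
    have eqV : classV b p x / (-(p : ℚ)) ^ (-(M : ℤ)) + classV b p xb / (-(p : ℚ)) ^ (-(M : ℤ))
          - 2 * h₁ * frameTV 1 L e - 2 * h₃ * frameTV 3 L e =
        (classV b p x / (-(p : ℚ)) ^ (-(M : ℤ)) - frameVPoly L e Hx
            + (-(p : ℚ)) ^ (classExp b p x + M) * gHat b p x * ((p : ℚ) ^ 3 * lambdaP p * wHat b p x))
          + (classV b p xb / (-(p : ℚ)) ^ (-(M : ℤ)) - frameVPoly L e Hc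
            + (-(p : ℚ)) ^ (classExp b p xb + M) * gHat b p xb * ((p : ℚ) ^ 3 * lambdaP p * wHat b p xb))
          + frameVPoly L e (Hc + Hx.comp (Polynomial.C (L : ℚ) - Polynomial.X)) + 2 * h₅ * frameTV 5 L e
          - ((-(p : ℚ)) ^ (classExp b p x + M) * gHat b p x * ((p : ℚ) ^ 3 * lambdaP p * wHat b p x)
            + (-(p : ℚ)) ^ (classExp b p xb + M) * gHat b p xb * ((p : ℚ) ^ 3 * lambdaP p * wHat b p xb)) := by
      have := elin; rw [hOV] at this
      unfold frameTV
      rw [pow_one]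
      linear_combination this
    rw [eqV]
    refine fo_sub (fo_add (fo_add (fo_add hVx hVc) hRV) ?_) hlam
    rw [padicNorm.mul, padicNorm.mul, h2n, one_mul]
    calc padicNorm p h₅ * padicNorm p (frameTV 5 L e) ≤ (p : ℚ) ^ (-(5 : ℤ)) * 1 :=
          mul_le_mul hn5 ht5V (padicNorm.nonneg _) (zpow_p_nonneg _)
      _ ≤ (p : ℚ) ^ (-(4 : ℤ)) := by rw [mul_one]; exact zpow_le_zpow_right₀ one_le_p (by norm_num)

end Pair

end Summit.KontsevichZagierPeriods.Zeta5Search.SecondOrder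

end
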